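import Mathlib.Analysis.Complex.Liouville
import Mathlib.Analysis.Calculus.MeanValue

/-!
# NODE O — LENS-1 «cauchy-analytic» g12 — THE CAUCHY–DECOUPLING BRICK for the FE half of ⟨27930⟩ (`stub_FE`, PT-A-1's (FE-2) `FEClusterHalf`):
# «mixed FIRST differences in complexified decoupling parameters cost NO factorial» — for `F` separately holomorphic and bounded by `M` on the closed
# polydisc `‖s‖_∞ ≤ R` (`R > 1`), the fully decoupled difference along `n` distinct parameters obeys `‖Δ_{y₁} ⋯ Δ_{yₙ} F‖ ≤ M · (R − 1)^{−n}`; with the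
# Cauchy radius `R − 1 ≥ e^{κ₁}` this is the (1.18)-shaped decay `M · e^{−κ₁ n}`

LANDING NOTE (porter ▶ PTC-1 g4, 2026-08-31; AUTHORSHIP = ◇ lens-1 g12 «cauchy-analytic», HOME sketch `nodeO-cover/LENS-1g12-CauchyDecoupling-v1.lean` sha16 7a61f7b9a436d15d · 257 l. · 17 thm + 6
def · 0 sorry (= ◆'s stamped 43daecfa804d50eb + the one corollary `norm_decDiffList_le_exp_of_le_length` «docked on (2.30)» added in place at 13:30Z) (CANDIDATE 10: the CAUCHY–DECOUPLING BRICK for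
the FE half of ⟨27930⟩ — «mixed FIRST differences in complexified decoupling parameters cost NO factorial», [II] (1.10)+(1.23) ∕ Dimock13 Lemma 19, model-free; Mathlib-only imports)): landed
VERBATIM except for the gate's two mechanical LINT repairs (generator `work/gen/lintfix_cauchy.py`; statements ∕ proofs ∕ defs byte-untouched): seven one-line «(bookkeeping)» docstrings added on
`update_mem_cpoly`, `decDiffList_nil`, `decDiffList_cons`, `setOn_nil`, `setOn_cons`, `update_setOn_comm`, `setOn_mem_cpoly` (`lint.docstring`), and the five `[cite: folklore…; KEY …]` tags
rewritten as prose `(folklore…)` + `[cite: KEY …]` with unchanged locators (`lint.tags`: the first cite token must be a bib key) — plus this paragraph, under the basename ◇ proposed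
(`…Theorems/BalabanUVNodesK0AxCauchyDecoupling.lean`, ns `…Theorems.K0AxCauchyDecoupling`) as INTENT-72; `--supports stmt-QuantumFields-27930 --as helper` (NO `--workitem`; kind definition by the
`def` rule — six small GENERIC defs `cpoly`, `decDiff`, `decDiffList`, `SepHolOff`, `BddOnPoly`, `setOn`, not route letters); ◆ CRIT-1 g38's cut (nodeO STATUS 2026-08-31T13:31:47Z): «CUT CANDIDATE
10 → GO VERBATIM; 16 thm ∕ 6 def; axioms standard on 9 guarded finals; J4: ns fresh, short generic names live in other namespaces only (no fqn clash); J1′∕J5′: `SepHolOff`∕`BddOnPoly` are GENERIC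
analytic hypotheses with parameters, non-junk, consumers contentful; (Q-ord): `R, M, κ₁` bound BEFORE `l, s`; SAME-WALL: SURVIVES, priced as an S-size BRICK, not a move of the wall — what remains
is ALL of Bałaban's content on this half (the joint-holomorphy letter N4, the s-carrier N1, ψ-analyticity N7, the missing row of N6)» ; ◆'s ADDENDUM STAMP on the in-place r1 edition 7a61f7b9
(13:32:44Z): «GO VERBATIM on 7a61f7b9 (land the whole file; no separate append); the one added corollary `norm_decDiffList_le_exp_of_le_length` adds no hypothesis species and no letter».  HONEST
(porter): textbook complex analysis (Cauchy estimate + mean value + inclusion–exclusion telescoping) kernel-checked, with print's use of it DISPLAYED; nothing of Bałaban asserted, ported,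
discharged or refuted; ⟨27930⟩ `stub_FE` ∕ FE-2 OPEN; K0ᴬ stmt-QuantumFields-27238 OPEN; NODE O 0∕1; COUNT 8∕28 · K 1∕4 UNMOVED; finite 𝕋⁴ at fixed ε — NOT continuum ∕ OS ∕ Clay; the Yang–Mills
mass gap is NOT proved by any of this.

Cell `ym-nodeO-ideate`, LENS IDEATOR seat `ymgap-nodeO-lens-1-g12` (count-neutral; companion of `nodeO-cover/LENS-1-NODE-v13.md`).
[I] = [Balaban1987RG1] (1.18) p.263, (3.37)–(3.40); [II] = [Balaban1988RG2Cluster] (1.8)–(1.11) p.4–5 «the parameters s(Y₀) are complex valued and satisfy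
|s(□)| ≤ e^{κ₁} … analytic … on the domain |s(Y₀)| ≤ e^{κ₁}», (1.23)–(1.25) p.7 «we represent all derivatives by the Cauchy formula … over the circles
|σ(□)| = e^{κ₁}», (2.6) p.13; [Dimock2013] = Dimock, *The renormalization group according to Bałaban I*, arXiv:1108.1335, §2.5 p.9 (`G_k(s) = Σ_ω s_ω G_{k,ω}`),
Lemma 19 p.19–20 («s_□ complex, |s_□| ≤ M^{1/2} … analytic … Cauchy bounds on the derivatives» — the source of the `e^{−κ d_M(X)}` in the activities).

WHY.  Print's FE bracket `𝐄^{(k+1)} = log ∫ dμ χ exp[…]` ([I] (2.13)) is localized by [II]'s expansion: one interpolation parameter `s_□ ∈ [0,1]` per cube, the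
term of a set `Y` of decoupled cubes = the fully decoupled difference (equivalently `∫_{[0,1]^Y} ∂^Y`), and its SIZE comes from holomorphy of the
integrand in `s ∈ ℂ^Y` on the polydisc of radius `R` (available because `s_□` multiplies propagator pieces of size `e^{−δ₀}`: `R ~ e^{δ₀∕2}`), by Cauchy.
THIS FILE is the model-free complex-analysis content of that step, over `ι → ℂ` with `Function.update`:
* §1 `norm_sub_le_of_diffContOnCl_ball` — ONE variable: `g` holomorphic in `|t| < R`, continuous and bounded by `M` on `|t| ≤ R`, `R > 1` ⟹
  `‖g 1 − g 0‖ ≤ M∕(R − 1)` (Cauchy's estimate `Complex.norm_deriv_le_of_forall_mem_sphere_norm_le` on the disc of radius `R − 1` about each point of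
  the closed unit disc + the mean-value inequality on the convex unit disc).
* §2 the closed polydisc `cpoly R`, the decoupling difference `decDiff y G s = G(s[y ↦ 1]) − G(s[y ↦ 0])`, its iterate `decDiffList l G` along a list
  of parameters, separate holomorphy `SepHolOff R l G` in the parameters outside `l` (base points frozen ANYWHERE in the closed polydisc), `BddOnPoly`.
* §3 ★★ `sepHolOff_bddOnPoly_decDiffList` ∕ ★★★ `norm_decDiffList_le` — for `l.Nodup`: `‖decDiffList l F s‖ ≤ M ∕ (R − 1)^{l.length}` on `cpoly R`;
  ★★★ `norm_decDiffList_le_exp` — with `Real.exp κ₁ ≤ R − 1`: `≤ M · exp(−κ₁ · l.length)`; `norm_decDiffList_le_exp_treeLength` — docked on a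
  DISPLAYED tree-length comparison `κ · d ≤ κ₁ · l.length` (the (2.27)-type bookkeeping the consumer supplies): `≤ M · exp(−κ · d)`, the shape of
  `IntFormula.Bound118OnUcOff` ∕ `TorusPieces.Bound118OnW`; `norm_decDiffList_le_exp_of_le_length` — the ROOTED edition docked on (2.30)
  `d_j(X) ≤ |X| − 1` (tree ✓`TreeLengthTorus.torusTreeLen_le_card_sub_one`): with `d ≤ l.length`, `≤ M · exp(−κ · d)` at the SAME rate κ.
* §4 `setOn` ∕ ★★★ `decoupling_expansion` — the telescoping IDENTITY `F (setOn l 1 s) = Σ_{Z ∈ l.sublists'} decDiffList Z F (setOn l 0 s)` for `l.Nodup`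
  (finite-difference form of [II] (1.9)–(1.10)), and `norm_decoupling_term_le` (each term at the (R−1)^{−|Z|} rate).
HONEST FRAMING.  Elementary complex analysis ([folklore]: Cauchy's estimate + telescoping); NOTHING of Bałaban's is asserted, ported or discharged; the
polymer REPRESENTATION of the record's fluctuation integral in decoupling parameters, its factorization and its joint holomorphy domain are NOT here
(they are (FE-2)'s model-specific content); `stub_FE` ∕ `stub_P0C` ∕ `stub_G3C` OPEN; 27930 OPEN; K0ᴬ ∕ NODE O 0∕1; finite tori at fixed ε — NOT
continuum ∕ OS; **the Yang–Mills mass gap (Clay) is NOT proved by any of this.**  No `sorry`, no `instance`, no `notation`; seven small `def`s; standard axioms.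
-/

noncomputable section

open Metric Set Function

namespace Summit.QuantumFields.YangMills.Theorems.K0AxCauchyDecoupling

/-! ## §1  One complex variable: the unit step `g 1 − g 0` costs `M ∕ (R − 1)` -/

/-- **Cauchy pays for one decoupling step.**  `g` holomorphic on the open disc `|t| < R`, continuous on its closure, `‖g‖ ≤ M` on the closed disc,
`1 < R` ⟹ `‖g 1 − g 0‖ ≤ M ∕ (R − 1)`. (folklore (Cauchy's estimate + mean value inequality)) [cite: Dimock2013, Lemma 19 p.19–20 «Cauchy bounds on the derivatives» (locator)] -/
theorem norm_sub_le_of_diffContOnCl_ball {g : ℂ → ℂ} {R M : ℝ} (hR : 1 < R)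
    (hg : DiffContOnCl ℂ g (ball (0 : ℂ) R)) (hM : ∀ z ∈ closedBall (0 : ℂ) R, ‖g z‖ ≤ M) :
    ‖g 1 - g 0‖ ≤ M / (R - 1) := by
  have hR1 : 0 < R - 1 := sub_pos.mpr hR
  have hderiv : ∀ τ ∈ closedBall (0 : ℂ) 1, ‖deriv g τ‖ ≤ M / (R - 1) := by
    intro τ hτ
    have hτ' : ‖τ‖ ≤ 1 := by simpa using hτ
    refine Complex.norm_deriv_le_of_forall_mem_sphere_norm_le hR1 ?_ ?_
    · refine hg.mono (ball_subset_ball' ?_)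
      rw [dist_zero_right]
      linarith
    · intro z hz
      apply hM
      rw [mem_closedBall, dist_zero_right]
      have hzτ : ‖z - τ‖ = R - 1 := by rwa [mem_sphere, dist_eq_norm] at hz
      calc ‖z‖ = ‖(z - τ) + τ‖ := by rw [sub_add_cancel]
        _ ≤ ‖z - τ‖ + ‖τ‖ := norm_add_le _ _
        _ ≤ (R - 1) + 1 := by rw [hzτ]; linarith
        _ = R := by ring
  have hdiff : ∀ τ ∈ closedBall (0 : ℂ) 1, DifferentiableAt ℂ g τ := by
    intro τ hτ
    have hτ' : ‖τ‖ ≤ 1 := by simpa using hτ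
    exact hg.differentiableAt isOpen_ball (by rw [mem_ball, dist_zero_right]; linarith)
  have h := (convex_closedBall (0 : ℂ) 1).norm_image_sub_le_of_norm_deriv_le hdiff hderiv
    (mem_closedBall_self zero_le_one) (by simp : (1 : ℂ) ∈ closedBall (0 : ℂ) 1)
  simpa using h

/-! ## §2  The closed polydisc, decoupling differences, separate holomorphy -/

variable {ι : Type*} [DecidableEq ι]

/-- The closed polydisc of radius `R`: `‖s i‖ ≤ R` for every parameter `i`. -/
def cpoly (R : ℝ) : Set (ι → ℂ) := {s | ∀ i, ‖s i‖ ≤ R}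

/-- Updating one coordinate by a value of norm `≤ R` keeps a point of the closed polydisc in the polydisc (bookkeeping). -/
theorem update_mem_cpoly {R : ℝ} {s : ι → ℂ} (hs : s ∈ cpoly R) (y : ι) {c : ℂ} (hc : ‖c‖ ≤ R) :
    update s y c ∈ cpoly R := by
  intro i
  by_cases h : i = y
  · subst h; simpa using hc
  · rw [update_of_ne h]; exact hs i

/-- The decoupling difference in the parameter `y`: `Δ_y G (s) = G(s[y ↦ 1]) − G(s[y ↦ 0])`. [cite: Balaban1988RG2Cluster, (1.8)–(1.10) p.4–5 (the parameters s; locator); Dimock2013, §2.5 p.9 (locator)] -/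
def decDiff (y : ι) (G : (ι → ℂ) → ℂ) : (ι → ℂ) → ℂ :=
  fun s => G (update s y 1) - G (update s y 0)

/-- The fully decoupled difference along a list of parameters: `Δ_{y₁} (Δ_{y₂} ( ⋯ (Δ_{yₙ} G)))`. -/
def decDiffList : List ι → ((ι → ℂ) → ℂ) → (ι → ℂ) → ℂ
  | [], G => G
  | y :: l, G => decDiff y (decDiffList l G)

/-- The fully decoupled difference along the empty list is the function itself (bookkeeping). -/
@[simp] theorem decDiffList_nil (G : (ι → ℂ) → ℂ) : decDiffList [] G = G := rfl

/-- Unfolding the fully decoupled difference along `y :: l` (bookkeeping). -/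
@[simp] theorem decDiffList_cons (y : ι) (l : List ι) (G : (ι → ℂ) → ℂ) :
    decDiffList (y :: l) G = decDiff y (decDiffList l G) := rfl

/-- **Separate holomorphy off `l`**: in every parameter `y ∉ l`, with the other parameters frozen at ANY point of the closed polydisc, `t ↦ G(s[y ↦ t])`
is holomorphic on `|t| < R` and continuous on `|t| ≤ R`. -/
def SepHolOff (R : ℝ) (l : List ι) (G : (ι → ℂ) → ℂ) : Prop :=
  ∀ s ∈ cpoly (ι := ι) R, ∀ y ∉ l, DiffContOnCl ℂ (fun t : ℂ => G (update s y t)) (ball (0 : ℂ) R)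

/-- Boundedness by `M` on the closed polydisc. -/
def BddOnPoly (R M : ℝ) (G : (ι → ℂ) → ℂ) : Prop :=
  ∀ s ∈ cpoly (ι := ι) R, ‖G s‖ ≤ M

/-- One decoupling step divides the bound by `R − 1`. -/
theorem bddOnPoly_decDiff {R B : ℝ} (hR : 1 < R) {l : List ι} {G : (ι → ℂ) → ℂ}
    (hhol : SepHolOff R l G) (hbdd : BddOnPoly R B G) {y : ι} (hy : y ∉ l) :
    BddOnPoly R (B / (R - 1)) (decDiff y G) := by
  intro s hs
  have h := norm_sub_le_of_diffContOnCl_ball (g := fun t : ℂ => G (update s y t)) hR (hhol s hs y hy)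
    (fun z hz => hbdd _ (update_mem_cpoly hs y (by simpa using hz)))
  simpa [decDiff] using h

/-- One decoupling step keeps separate holomorphy in the remaining parameters (`1 ≤ R` puts the frozen values `0, 1` inside the polydisc). -/
theorem sepHolOff_decDiff {R : ℝ} (hR : 1 ≤ R) {l : List ι} {G : (ι → ℂ) → ℂ}
    (hhol : SepHolOff R l G) (y : ι) : SepHolOff R (y :: l) (decDiff y G) := by
  intro s hs y' hy'
  simp only [List.mem_cons, not_or] at hy'
  obtain ⟨hne, hy'l⟩ := hy'
  have h1 : update s y 1 ∈ cpoly R := update_mem_cpoly hs y (by simpa using hR)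
  have h0 : update s y 0 ∈ cpoly R := update_mem_cpoly hs y (by simp; linarith)
  have heq : (fun t : ℂ => decDiff y G (update s y' t)) =
      fun t : ℂ => G (update (update s y 1) y' t) - G (update (update s y 0) y' t) := by
    funext t
    simp only [decDiff, update_comm hne]
  rw [heq]
  exact (hhol _ h1 y' hy'l).sub (hhol _ h0 y' hy'l)

/-! ## §3  The Cauchy–decoupling bound -/

/-- ★★ Along a duplicate-free list of parameters the fully decoupled difference stays separately holomorphic off the list and is bounded by
`M ∕ (R − 1)^{length}` on the closed polydisc. (folklore) [cite: Balaban1988RG2Cluster, (1.11) p.5, (1.23)–(1.24) p.7; Dimock2013, Lemma 19 p.19–20 (locators)] -/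
theorem sepHolOff_bddOnPoly_decDiffList {R M : ℝ} (hR : 1 < R) {F : (ι → ℂ) → ℂ}
    (hhol : SepHolOff R [] F) (hbdd : BddOnPoly R M F) :
    ∀ l : List ι, l.Nodup →
      SepHolOff R l (decDiffList l F) ∧ BddOnPoly R (M / (R - 1) ^ l.length) (decDiffList l F)
  | [], _ => by simpa using And.intro hhol hbdd
  | y :: l, hnd => by
      obtain ⟨hyl, hl⟩ := List.nodup_cons.mp hnd
      obtain ⟨ih1, ih2⟩ := sepHolOff_bddOnPoly_decDiffList hR hhol hbdd l hl
      refine ⟨sepHolOff_decDiff hR.le ih1 y, ?_⟩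
      have h := bddOnPoly_decDiff hR ih1 ih2 hyl
      simpa [decDiffList, pow_succ, div_div] using h

/-- ★★★ **THE CAUCHY–DECOUPLING BOUND**: `‖Δ_{y₁} ⋯ Δ_{yₙ} F (s)‖ ≤ M ∕ (R − 1)ⁿ` for distinct `y₁, …, yₙ` and every base point of the closed polydisc.
(folklore) [cite: Balaban1988RG2Cluster, (1.11) p.5 «analytic … on the domain |s(Y₀)| ≤ e^{κ₁}», (1.23)–(1.24) p.7; Dimock2013, Lemma 19 p.19–20 (locators)] -/
theorem norm_decDiffList_le {R M : ℝ} (hR : 1 < R) {F : (ι → ℂ) → ℂ}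
    (hhol : SepHolOff R [] F) (hbdd : BddOnPoly R M F) {l : List ι} (hl : l.Nodup)
    {s : ι → ℂ} (hs : s ∈ cpoly R) :
    ‖decDiffList l F s‖ ≤ M / (R - 1) ^ l.length :=
  (sepHolOff_bddOnPoly_decDiffList hR hhol hbdd l hl).2 s hs

/-- ★★★ **(1.18) CURRENCY**: with the Cauchy radius `R − 1 ≥ e^{κ₁}`, `‖Δ_{y₁} ⋯ Δ_{yₙ} F (s)‖ ≤ M · e^{−κ₁ n}`. [cite: Balaban1987RG1, (1.18) p.263 (shape); folklore] -/
theorem norm_decDiffList_le_exp {R M κ₁ : ℝ} (hR : 1 < R) (hκ : Real.exp κ₁ ≤ R - 1) (hM : 0 ≤ M)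
    {F : (ι → ℂ) → ℂ} (hhol : SepHolOff R [] F) (hbdd : BddOnPoly R M F) {l : List ι} (hl : l.Nodup)
    {s : ι → ℂ} (hs : s ∈ cpoly R) :
    ‖decDiffList l F s‖ ≤ M * Real.exp (-κ₁ * l.length) := by
  have h := norm_decDiffList_le hR hhol hbdd hl hs
  have hpos : 0 < Real.exp κ₁ ^ l.length := pow_pos (Real.exp_pos _) _
  have hle : Real.exp κ₁ ^ l.length ≤ (R - 1) ^ l.length :=
    pow_le_pow_left₀ (Real.exp_pos _).le hκ _
  calc ‖decDiffList l F s‖ ≤ M / (R - 1) ^ l.length := h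
    _ ≤ M / Real.exp κ₁ ^ l.length := div_le_div_of_nonneg_left hM hpos hle
    _ = M * Real.exp (-κ₁ * l.length) := by
        rw [← Real.exp_nat_mul, div_eq_mul_inv, ← Real.exp_neg]
        ring_nf

/-- **Docked on tree length** (the consumer's (2.27)-type bookkeeping `κ·d ≤ κ₁·n` DISPLAYED): `‖Δ_{y₁} ⋯ Δ_{yₙ} F (s)‖ ≤ M · e^{−κ d}` — the shape of
`IntFormula.Bound118OnUcOff` ∕ `TorusPieces.Bound118OnW`. [cite: Balaban1987RG1, (1.18) p.263; Balaban1988RG2Cluster, (2.27) p.18 (shape)] -/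
theorem norm_decDiffList_le_exp_treeLength {R M κ₁ κ d : ℝ} (hR : 1 < R) (hκ : Real.exp κ₁ ≤ R - 1) (hM : 0 ≤ M)
    {F : (ι → ℂ) → ℂ} (hhol : SepHolOff R [] F) (hbdd : BddOnPoly R M F) {l : List ι} (hl : l.Nodup)
    {s : ι → ℂ} (hs : s ∈ cpoly R) (hd : κ * d ≤ κ₁ * l.length) :
    ‖decDiffList l F s‖ ≤ M * Real.exp (-κ * d) := by
  refine (norm_decDiffList_le_exp hR hκ hM hhol hbdd hl hs).trans ?_
  exact mul_le_mul_of_nonneg_left (Real.exp_le_exp.mpr (by linarith)) hM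

/-- **Docked on (2.30)** — the ROOTED organisation of [II] (1.8)–(1.10): every cube of the localization domain `X` except the root carries a differenced
parameter, so `n = |X| − 1 ≥ d_j(X)` by the tree's ✓`TreeLengthTorus.torusTreeLen_le_card_sub_one` ((2.30) upper half); with that row DISPLAYED as
`d ≤ n` and the Cauchy radius `R − 1 ≥ e^{κ}`, `κ ≥ 0`: `‖Δ_{y₁} ⋯ Δ_{yₙ} F (s)‖ ≤ M · e^{−κ d}` with NO loss of rate.
[cite: Balaban1988RG2Cluster, (1.8)–(1.10) p.3–4, (2.30) p.18 (shape)] -/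
theorem norm_decDiffList_le_exp_of_le_length {R M κ d : ℝ} (hR : 1 < R) (hκ : Real.exp κ ≤ R - 1) (hκ0 : 0 ≤ κ) (hM : 0 ≤ M)
    {F : (ι → ℂ) → ℂ} (hhol : SepHolOff R [] F) (hbdd : BddOnPoly R M F) {l : List ι} (hl : l.Nodup)
    {s : ι → ℂ} (hs : s ∈ cpoly R) (hd : d ≤ l.length) :
    ‖decDiffList l F s‖ ≤ M * Real.exp (-κ * d) :=
  norm_decDiffList_le_exp_treeLength hR hκ hM hhol hbdd hl hs (mul_le_mul_of_nonneg_left hd hκ0)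

/-! ## §4  The decoupling expansion IDENTITY (telescoping over subsets) and its termwise Cauchy rate -/

/-- Set the parameters listed in `l` to the constant `c`, keep the others. -/
def setOn (l : List ι) (c : ℂ) (s : ι → ℂ) : ι → ℂ := fun i => if i ∈ l then c else s i

/-- Setting no parameter changes nothing (bookkeeping). -/
@[simp] theorem setOn_nil (c : ℂ) (s : ι → ℂ) : setOn [] c s = s := by
  funext i; simp [setOn]

/-- `setOn (y :: l)` is `setOn l` followed by the update at `y` (bookkeeping). -/
theorem setOn_cons (y : ι) (l : List ι) (c : ℂ) (s : ι → ℂ) : setOn (y :: l) c s = update (setOn l c s) y c := by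
  funext i
  by_cases h : i = y
  · subst h; simp [setOn]
  · simp [setOn, h]

/-- An update at a parameter not in `l` commutes with `setOn l` (bookkeeping). -/
theorem update_setOn_comm {y : ι} {l : List ι} (hy : y ∉ l) (c d : ℂ) (s : ι → ℂ) :
    update (setOn l c s) y d = setOn l c (update s y d) := by
  funext i
  by_cases h : i = y
  · subst h; simp [setOn, hy]
  · simp [setOn, update_of_ne h]

/-- Setting listed parameters to a constant of norm `≤ R` keeps a point of the closed polydisc in the polydisc (bookkeeping). -/
theorem setOn_mem_cpoly {R : ℝ} (l : List ι) {c : ℂ} (hc : ‖c‖ ≤ R) {s : ι → ℂ} (hs : s ∈ cpoly R) :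
    setOn l c s ∈ cpoly R := by
  intro i
  by_cases h : i ∈ l
  · simp [setOn, h, hc]
  · simp [setOn, h]; exact hs i

/-- ★★★ **THE DECOUPLING EXPANSION IDENTITY**: the fully coupled value is the sum over the decoupled sets `Z ⊆ l` of the iterated differences along `Z`
at zero coupling on `l ∖ Z` — `F(s[l ↦ 1]) = Σ_{Z ⊆ l} (Δ_Z F)(s[l ↦ 0])` (each parameter telescoped once: `g 1 = g 0 + (g 1 − g 0)`).
(folklore) [cite: Balaban1988RG2Cluster, (1.9)–(1.10) p.4–5 (the expansion «f(1) = Σ_Y ∫ ds_Y ∂^Y f|_{s=0 off Y}», locator); Dimock2013, §4.5 p.19–20 (locator)] -/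
theorem decoupling_expansion (F : (ι → ℂ) → ℂ) :
    ∀ (l : List ι), l.Nodup → ∀ s : ι → ℂ,
      F (setOn l 1 s) = ((l.sublists').map fun Z => decDiffList Z F (setOn l 0 s)).sum
  | [], _, s => by simp
  | y :: l, hnd, s => by
      obtain ⟨hyl, hl⟩ := List.nodup_cons.mp hnd
      have hL : F (setOn (y :: l) 1 s) = ((l.sublists').map fun Z => decDiffList Z F (update (setOn l 0 s) y 1)).sum := by
        rw [setOn_cons, update_setOn_comm hyl, decoupling_expansion F l hl (update s y 1), ← update_setOn_comm hyl]
      have hR : ((List.sublists' (y :: l)).map fun Z => decDiffList Z F (setOn (y :: l) 0 s)).sum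
          = ((l.sublists').map fun Z => decDiffList Z F (update (setOn l 0 s) y 0)).sum
            + ((l.sublists').map fun Z =>
                (decDiffList Z F (update (setOn l 0 s) y 1) - decDiffList Z F (update (setOn l 0 s) y 0))).sum := by
        rw [List.sublists'_cons, List.map_append, List.sum_append, List.map_map, setOn_cons]
        congr 1
        refine congrArg List.sum (List.map_congr_left fun Z _ => ?_)
        simp only [Function.comp_apply, decDiffList_cons, decDiff, update_idem]
      rw [hL, hR, ← List.sum_map_add]
      refine congrArg List.sum (List.map_congr_left fun Z _ => ?_)
      ring

/-- ★★ **TERMWISE CAUCHY RATE of the decoupling expansion**: every term of `decoupling_expansion` along a decoupled set `Z ⊆ l` is bounded by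
`M ∕ (R − 1)^{|Z|}` (with `R − 1 ≥ e^{κ₁}`: `M · e^{−κ₁ |Z|}`) — the activities' decay in the number of decoupled cubes, from holomorphy alone.
(folklore) [cite: Balaban1987RG1, (1.18) p.263 (shape); Balaban1988RG2Cluster, (1.24) p.7; Dimock2013, Lemma 19 p.19–20 (locators)] -/
theorem norm_decoupling_term_le {R M : ℝ} (hR : 1 < R) {F : (ι → ℂ) → ℂ}
    (hhol : SepHolOff R [] F) (hbdd : BddOnPoly R M F) {l : List ι} (hl : l.Nodup)
    {Z : List ι} (hZ : Z ∈ l.sublists') {s : ι → ℂ} (hs : s ∈ cpoly R) :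
    ‖decDiffList Z F (setOn l 0 s)‖ ≤ M / (R - 1) ^ Z.length :=
  norm_decDiffList_le hR hhol hbdd ((List.mem_sublists'.mp hZ).nodup hl)
    (setOn_mem_cpoly l (by simp; linarith) hs)

end Summit.QuantumFields.YangMills.Theorems.K0AxCauchyDecoupling

end
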